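import Mathlib.Analysis.InnerProductSpace.Projection.Reflection
import Literature.Geometry.DiscreteGeometry.LayerShells
import Summits.AtomisticToContinuum.Crystallization.Theorems.HullExactificationCascadeExactHcpLocalTheoremShell

/-!
# Route HullExactificationCascade — item `ExactHcpLocalTheorem` (G), helper 2: the frame and the mirrors of hcp

Helper file 2 for `stmt-AtomisticToContinuum-12093` (the `η = 0` hcp local theorem).  Inner products
of the frame `u = 𝔰 0 1 0`, `v = 𝔰 0 0 1`, `u − v`, `h e₃` with the sites
`𝔰 k i j = barlowPos a h alternatingHagg k i j`; the three mirrors of the hcp stabiliser of the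
origin as Householder reflections (Mathlib `Submodule.reflection (ℝ ∙ n)ᗮ`): `M_u` (normal `u`):
`(k,i,j) ↦ (k, −i−j−L(k), j)`, `M_{u−v}` (normal `u − v`): `(k,i,j) ↦ (k,j,i)`, `σ_h` (normal
`e₃`): `(k,i,j) ↦ (−k,i,j)`; they preserve the stacking and hence the cluster
`N = {p ∈ hcp | ‖p‖ < 13/10 a}`; the tree's `halfTurn` on sites; and the transitivity of the
stabiliser on the six hexagon sites and on the six cap sites of the cluster (words in the
mirrors).  Elementary ([folklore]; the stabiliser is `D_{3h}`, Conway–Sloane Ch. 1 §1.3).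
-/

noncomputable section

namespace Summit.AtomisticToContinuum.Crystallization.Theorems.ExactHcpLocal

open Literature.MathematicalPhysics.StatisticalMechanics

variable {a h : ℝ}

/-! ## Frame file: inner products with sites, the three mirrors of hcp and the half-turn -/

section Frame

open RealInnerProductSpace Literature.Geometry.DiscreteGeometry

variable (a h)

/-- `⟪u, 𝔰 k i j⟫ = a² (i + j/2 + L/2)` for the first in-layer generator `u = 𝔰 0 1 0`. [folklore] -/
theorem inner_u_site (k i j : ℤ) :
    ⟪barlowPos a h alternatingHagg 0 1 0, barlowPos a h alternatingHagg k i j⟫ =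
      a ^ 2 * (i + j / 2 + haggLabel alternatingHagg k / 2) := by
  rw [inner_fin3]
  simp
  ring

/-- `⟪v, 𝔰 k i j⟫ = a² (i/2 + j + L/2)` for the second in-layer generator `v = 𝔰 0 0 1`.
[folklore] -/
theorem inner_v_site (k i j : ℤ) :
    ⟪barlowPos a h alternatingHagg 0 0 1, barlowPos a h alternatingHagg k i j⟫ =
      a ^ 2 * (i / 2 + j + haggLabel alternatingHagg k / 2) := by
  rw [inner_fin3]
  have h3 : Real.sqrt 3 ^ 2 = 3 := Real.sq_sqrt (by norm_num)
  simp
  linear_combination (a ^ 2 / 4 * ((j : ℝ) + haggLabel alternatingHagg k / 3)) * h3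

/-- `⟪u − v, 𝔰 k i j⟫ = a² (i − j)/2`. [folklore] -/
theorem inner_uv_site (k i j : ℤ) :
    ⟪barlowPos a h alternatingHagg 0 1 0 - barlowPos a h alternatingHagg 0 0 1,
      barlowPos a h alternatingHagg k i j⟫ = a ^ 2 * (i - j) / 2 := by
  rw [inner_sub_left, inner_u_site, inner_v_site]
  ring

/-- `⟪h e₃, 𝔰 k i j⟫ = k h²`. [folklore] -/
theorem inner_e_site (k i j : ℤ) :
    ⟪layerNormal h, barlowPos a h alternatingHagg k i j⟫ = k * h ^ 2 := by
  rw [inner_fin3]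
  simp [layerNormal]
  ring

/-- `‖u‖² = a²`. [folklore] -/
theorem norm_sq_u : ‖barlowPos a h alternatingHagg 0 1 0‖ ^ 2 = a ^ 2 := by
  rw [hcp_norm_sq_eq, haggLabel_zero]; push_cast; ring

/-- `‖u − v‖² = a²`. [folklore] -/
theorem norm_sq_uv :
    ‖barlowPos a h alternatingHagg 0 1 0 - barlowPos a h alternatingHagg 0 0 1‖ ^ 2 = a ^ 2 := by
  rw [site_sub_of_even (a := a) (h := h) Even.zero]
  norm_num
  rw [hcp_norm_sq_eq, haggLabel_zero]
  push_cast; ring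

/-- `‖h e₃‖² = h²`. [folklore] -/
theorem norm_sq_e : ‖layerNormal h‖ ^ 2 = h ^ 2 := by
  rw [norm_sq_fin3]; simp [layerNormal]

variable {a h}

/-- **Householder formula** for the mirror with normal `n`:
`reflection (ℝ ∙ n)ᗮ x = x − (2 ⟪n, x⟫ / ‖n‖²) n`. [folklore] -/
theorem mirror_apply (n x : EuclideanSpace ℝ (Fin 3)) :
    (ℝ ∙ n)ᗮ.reflection x = x - (2 * ⟪n, x⟫ / ‖n‖ ^ 2) • n := by
  rw [Submodule.reflection_orthogonal_apply, Submodule.reflection_singleton_apply]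
  simp only [two_smul, RCLike.ofReal_real_eq_id, id_eq]
  module

/-- A mirror preserves membership in a set stable under it (mirrors are involutions). [folklore] -/
theorem mem_iff_mirror_mem {n : EuclideanSpace ℝ (Fin 3)} {H : Set (EuclideanSpace ℝ (Fin 3))}
    (hH : ∀ x ∈ H, (ℝ ∙ n)ᗮ.reflection x ∈ H) (x : EuclideanSpace ℝ (Fin 3)) :
    (ℝ ∙ n)ᗮ.reflection x ∈ H ↔ x ∈ H := by
  refine ⟨fun hx => ?_, hH x⟩
  have := hH _ hx
  rwa [Submodule.reflection_reflection] at this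

/-- **The mirror `M_u` (normal `u`) on sites**: `(k, i, j) ↦ (k, −i−j−L(k), j)`. [folklore] -/
theorem mirrorU_site (ha : a ≠ 0) (k i j : ℤ) :
    (ℝ ∙ barlowPos a h alternatingHagg 0 1 0)ᗮ.reflection (barlowPos a h alternatingHagg k i j) =
      barlowPos a h alternatingHagg k (-i - j - haggLabel alternatingHagg k) j := by
  rw [mirror_apply, inner_u_site, norm_sq_u]
  have : 2 * (a ^ 2 * ((i : ℝ) + j / 2 + haggLabel alternatingHagg k / 2)) / a ^ 2 =
      2 * i + j + haggLabel alternatingHagg k := by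
    field_simp
  rw [this]
  simp only [barlowPos, haggLabel_zero]
  push_cast
  module

/-- **The mirror `M_{u−v}` (normal `u − v`) on sites**: `(k, i, j) ↦ (k, j, i)` (it swaps `u`
and `v` and fixes `w` and `e₃`). [folklore] -/
theorem mirrorUV_site (ha : a ≠ 0) (k i j : ℤ) :
    (ℝ ∙ (barlowPos a h alternatingHagg 0 1 0 - barlowPos a h alternatingHagg 0 0 1))ᗮ.reflection
        (barlowPos a h alternatingHagg k i j) = barlowPos a h alternatingHagg k j i := by
  rw [mirror_apply, inner_uv_site, norm_sq_uv]
  have : 2 * (a ^ 2 * ((i : ℝ) - j) / 2) / a ^ 2 = i - j := by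
    field_simp
  rw [this]
  have hw : barlowOffset a = (1 / 3 : ℝ) • (triangularVec₁ a + triangularVec₂ a) := by
    rw [← three_smul_barlowOffset, smul_smul]; norm_num
  simp only [barlowPos, haggLabel_zero, hw]
  push_cast
  module

/-- **The horizontal mirror `σ_h` (normal `e₃`) on sites**: `(k, i, j) ↦ (−k, i, j)`. [folklore] -/
theorem mirrorH_site (hh : h ≠ 0) (k i j : ℤ) :
    (ℝ ∙ layerNormal h)ᗮ.reflection (barlowPos a h alternatingHagg k i j) =
      barlowPos a h alternatingHagg (-k) i j := by
  rw [mirror_apply, inner_e_site, norm_sq_e]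
  have : 2 * ((k : ℝ) * h ^ 2) / h ^ 2 = 2 * k := by
    field_simp
  rw [this]
  have hL : haggLabel alternatingHagg (-k) = haggLabel alternatingHagg k := by
    rcases Int.even_or_odd k with hk | hk
    · rw [haggLabel_alternating_of_even hk, haggLabel_alternating_of_even hk.neg]
    · rw [haggLabel_alternating_of_odd hk, haggLabel_alternating_of_odd hk.neg]
  simp only [barlowPos, hL]
  push_cast
  module

/-- **The half-turn on sites**: `halfTurn (𝔰 k i j) = 𝔰 (1+k) (−i) (−j) − 𝔰 1 0 0`. [folklore] -/
theorem halfTurn_site (k i j : ℤ) :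
    halfTurn (barlowPos a h alternatingHagg k i j) =
      barlowPos a h alternatingHagg (1 + k) (-i) (-j) - barlowPos a h alternatingHagg 1 0 0 := by
  rw [eq_sub_iff_add_eq, add_comm]
  have := hcp_add_halfTurn_of_odd a h odd_one 0 0 k i j
  simpa using this

/-- `M_u` preserves the stacking. [folklore] -/
theorem mirrorU_mem_iff (ha : a ≠ 0) (x : EuclideanSpace ℝ (Fin 3)) :
    (ℝ ∙ barlowPos a h alternatingHagg 0 1 0)ᗮ.reflection x ∈ hcpStacking a h ↔
      x ∈ hcpStacking a h := by
  refine mem_iff_mirror_mem (fun y hy => ?_) x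
  obtain ⟨k, i, j, rfl⟩ := hy
  rw [mirrorU_site ha]
  exact barlowPos_mem _ _ _

/-- `M_{u−v}` preserves the stacking. [folklore] -/
theorem mirrorUV_mem_iff (ha : a ≠ 0) (x : EuclideanSpace ℝ (Fin 3)) :
    (ℝ ∙ (barlowPos a h alternatingHagg 0 1 0 - barlowPos a h alternatingHagg 0 0 1))ᗮ.reflection x
        ∈ hcpStacking a h ↔ x ∈ hcpStacking a h := by
  refine mem_iff_mirror_mem (fun y hy => ?_) x
  obtain ⟨k, i, j, rfl⟩ := hy
  rw [mirrorUV_site ha]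
  exact barlowPos_mem _ _ _

/-- `σ_h` preserves the stacking. [folklore] -/
theorem mirrorH_mem_iff (hh : h ≠ 0) (x : EuclideanSpace ℝ (Fin 3)) :
    (ℝ ∙ layerNormal h)ᗮ.reflection x ∈ hcpStacking a h ↔ x ∈ hcpStacking a h := by
  refine mem_iff_mirror_mem (fun y hy => ?_) x
  obtain ⟨k, i, j, rfl⟩ := hy
  rw [mirrorH_site hh]
  exact barlowPos_mem _ _ _

/-- **A linear isometry preserving the stacking preserves the cluster**
`N = {p ∈ hcp | ‖p‖ < r}`. [folklore] -/
theorem image_cluster_eq_of_mem_iff {g : EuclideanSpace ℝ (Fin 3) ≃ₗᵢ[ℝ] EuclideanSpace ℝ (Fin 3)}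
    (hg : ∀ x, g x ∈ hcpStacking a h ↔ x ∈ hcpStacking a h) (r : ℝ) :
    g '' {p | p ∈ hcpStacking a h ∧ ‖p‖ < r} = {p | p ∈ hcpStacking a h ∧ ‖p‖ < r} := by
  ext x
  simp only [Set.mem_image, Set.mem_setOf_eq]
  constructor
  · rintro ⟨y, ⟨hy, hyr⟩, rfl⟩
    exact ⟨(hg y).2 hy, by rwa [LinearIsometryEquiv.norm_map]⟩
  · rintro ⟨hx, hxr⟩
    refine ⟨g.symm x, ⟨?_, by rwa [LinearIsometryEquiv.norm_map]⟩, g.apply_symm_apply x⟩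
    rw [← hg, g.apply_symm_apply]
    exact hx

/-- Composition preserves "preserves the stacking". [folklore] -/
theorem trans_mem_iff {g g' : EuclideanSpace ℝ (Fin 3) ≃ₗᵢ[ℝ] EuclideanSpace ℝ (Fin 3)}
    (hg : ∀ x, g x ∈ hcpStacking a h ↔ x ∈ hcpStacking a h)
    (hg' : ∀ x, g' x ∈ hcpStacking a h ↔ x ∈ hcpStacking a h) (x : EuclideanSpace ℝ (Fin 3)) :
    (g.trans g') x ∈ hcpStacking a h ↔ x ∈ hcpStacking a h := by
  rw [LinearIsometryEquiv.trans_apply, hg', hg]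

/-- **The stabiliser of hcp is transitive on the hexagon**: for each of the six hexagon sites
`q = 𝔰 0 i j` there is a linear isometry preserving the stacking that maps `u = 𝔰 0 1 0` to `q`
(words in the mirrors `M_u`, `M_{u−v}`). [folklore] -/
theorem exists_sym_apply_u (ha : a ≠ 0) {i j : ℤ}
    (hij : -1 ≤ i ∧ i ≤ 1 ∧ -1 ≤ j ∧ j ≤ 1 ∧ -1 ≤ i + j ∧ i + j ≤ 1) (h0 : ¬ (i = 0 ∧ j = 0)) :
    ∃ g : EuclideanSpace ℝ (Fin 3) ≃ₗᵢ[ℝ] EuclideanSpace ℝ (Fin 3),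
      (∀ x, g x ∈ hcpStacking a h ↔ x ∈ hcpStacking a h) ∧
        g (barlowPos a h alternatingHagg 0 1 0) = barlowPos a h alternatingHagg 0 i j := by
  set Mu := (ℝ ∙ barlowPos a h alternatingHagg 0 1 0)ᗮ.reflection with hMu
  set Muv := (ℝ ∙ (barlowPos a h alternatingHagg 0 1 0 - barlowPos a h alternatingHagg 0 0 1))ᗮ.reflection
    with hMuv
  have hU : ∀ x, Mu x ∈ hcpStacking a h ↔ x ∈ hcpStacking a h := mirrorU_mem_iff ha
  have hUV : ∀ x, Muv x ∈ hcpStacking a h ↔ x ∈ hcpStacking a h := mirrorUV_mem_iff ha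
  have hL0 : haggLabel alternatingHagg 0 = 0 := haggLabel_zero _
  have eU : ∀ i j : ℤ, Mu (barlowPos a h alternatingHagg 0 i j) =
      barlowPos a h alternatingHagg 0 (-i - j) j := fun i j => by
    rw [hMu, mirrorU_site ha, hL0, sub_zero]
  have eUV : ∀ i j : ℤ, Muv (barlowPos a h alternatingHagg 0 i j) =
      barlowPos a h alternatingHagg 0 j i := fun i j => by rw [hMuv, mirrorUV_site ha]
  obtain ⟨hi1, hi2, hj1, hj2, hs1, hs2⟩ := hij
  interval_cases i <;> interval_cases j
  · exact absurd hs1 (by norm_num)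
  · -- `(-1, 0) = -u`: `M_u`
    exact ⟨Mu, hU, by rw [eU]; norm_num⟩
  · -- `(-1, 1) = v - u`: `M_{u-v}` then `M_u`
    refine ⟨Muv.trans Mu, trans_mem_iff hUV hU, ?_⟩
    rw [LinearIsometryEquiv.trans_apply, eUV, eU]; norm_num
  · -- `(0, -1) = -v`: `M_u` then `M_{u-v}`
    refine ⟨Mu.trans Muv, trans_mem_iff hU hUV, ?_⟩
    rw [LinearIsometryEquiv.trans_apply, eU, eUV]; norm_num
  · exact absurd ⟨rfl, rfl⟩ h0
  · -- `(0, 1) = v`: `M_{u-v}`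
    exact ⟨Muv, hUV, by rw [eUV]⟩
  · -- `(1, -1) = u - v`: `M_{u-v}`, `M_u`, `M_{u-v}`
    refine ⟨(Muv.trans Mu).trans Muv, trans_mem_iff (trans_mem_iff hUV hU) hUV, ?_⟩
    rw [LinearIsometryEquiv.trans_apply, LinearIsometryEquiv.trans_apply, eUV, eU, eUV]; norm_num
  · -- `(1, 0) = u`: identity
    exact ⟨LinearIsometryEquiv.refl ℝ _, fun x => Iff.rfl, rfl⟩
  · exact absurd hs2 (by norm_num)

/-- **The stabiliser of hcp is transitive on the six cap sites**: for each cap site `q = 𝔰 k i j`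
(`k = ±1`) there is a linear isometry preserving the stacking mapping `w + h e₃ = 𝔰 1 0 0` to `q`
(words in `M_u`, `M_{u−v}`, `σ_h`). [folklore] -/
theorem exists_sym_apply_cap (ha : a ≠ 0) (hh : h ≠ 0) {k i j : ℤ} (hk : k = 1 ∨ k = -1)
    (hij : -1 ≤ i ∧ i ≤ 0 ∧ -1 ≤ j ∧ j ≤ 0 ∧ -1 ≤ i + j) :
    ∃ g : EuclideanSpace ℝ (Fin 3) ≃ₗᵢ[ℝ] EuclideanSpace ℝ (Fin 3),
      (∀ x, g x ∈ hcpStacking a h ↔ x ∈ hcpStacking a h) ∧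
        g (barlowPos a h alternatingHagg 1 0 0) = barlowPos a h alternatingHagg k i j := by
  set Mu := (ℝ ∙ barlowPos a h alternatingHagg 0 1 0)ᗮ.reflection with hMu
  set Muv := (ℝ ∙ (barlowPos a h alternatingHagg 0 1 0 - barlowPos a h alternatingHagg 0 0 1))ᗮ.reflection
    with hMuv
  set Mh := (ℝ ∙ layerNormal h)ᗮ.reflection with hMh
  have hU : ∀ x, Mu x ∈ hcpStacking a h ↔ x ∈ hcpStacking a h := mirrorU_mem_iff ha
  have hUV : ∀ x, Muv x ∈ hcpStacking a h ↔ x ∈ hcpStacking a h := mirrorUV_mem_iff ha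
  have hH : ∀ x, Mh x ∈ hcpStacking a h ↔ x ∈ hcpStacking a h := mirrorH_mem_iff hh
  have hL1 : haggLabel alternatingHagg 1 = 1 := haggLabel_alternating_of_odd odd_one
  have eU : ∀ i j : ℤ, Mu (barlowPos a h alternatingHagg 1 i j) =
      barlowPos a h alternatingHagg 1 (-i - j - 1) j := fun i j => by
    rw [hMu, mirrorU_site ha, hL1]
  have eUV : ∀ i j : ℤ, Muv (barlowPos a h alternatingHagg 1 i j) =
      barlowPos a h alternatingHagg 1 j i := fun i j => by rw [hMuv, mirrorUV_site ha]
  have eH : ∀ i j : ℤ, Mh (barlowPos a h alternatingHagg 1 i j) =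
      barlowPos a h alternatingHagg (-1) i j := fun i j => by rw [hMh, mirrorH_site hh]
  -- the three top caps
  have top : ∀ i j : ℤ, -1 ≤ i → i ≤ 0 → -1 ≤ j → j ≤ 0 → -1 ≤ i + j →
      ∃ g : EuclideanSpace ℝ (Fin 3) ≃ₗᵢ[ℝ] EuclideanSpace ℝ (Fin 3),
        (∀ x, g x ∈ hcpStacking a h ↔ x ∈ hcpStacking a h) ∧
          g (barlowPos a h alternatingHagg 1 0 0) = barlowPos a h alternatingHagg 1 i j := by
    intro i j hi1 hi2 hj1 hj2 hs
    interval_cases i <;> interval_cases j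
    · exact absurd hs (by norm_num)
    · -- `(1,-1,0) = w - u + e`: `M_u`
      exact ⟨Mu, hU, by rw [eU]; norm_num⟩
    · -- `(1,0,-1) = w - v + e`: `M_u` then `M_{u-v}`
      refine ⟨Mu.trans Muv, trans_mem_iff hU hUV, ?_⟩
      rw [LinearIsometryEquiv.trans_apply, eU, eUV]; norm_num
    · exact ⟨LinearIsometryEquiv.refl ℝ _, fun x => Iff.rfl, rfl⟩
  obtain ⟨hi1, hi2, hj1, hj2, hs⟩ := hij
  rcases hk with rfl | rfl
  · exact top i j hi1 hi2 hj1 hj2 hs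
  · obtain ⟨g, hg, hgq⟩ := top i j hi1 hi2 hj1 hj2 hs
    refine ⟨g.trans Mh, trans_mem_iff hg hH, ?_⟩
    rw [LinearIsometryEquiv.trans_apply, hgq, eH]

end Frame

end Summit.AtomisticToContinuum.Crystallization.Theorems.ExactHcpLocal

end
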